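import Summits.CriticalPhenomena.PercolationContinuityZ3.Theorems.Transplant.SiteKNValid
import Literature.Probability.Percolation.KozmaNitzanTheorem6
import HarnessLib

/-!
# SITE Kozma–Nitzan §4 — what an occupied macro-vertex certifies: an infinite macro-cluster of the site scheme forces
# `0 ↔^{site} ∞`

builds on p205010 (kernel theorem, internal audit signed; external expert review pending).
Lane `prim-bschramm`, class C1a (site percolation on `ℤ³`); block (γ) of the SITE same-`p` witness
(`SiteSameP.SiteSamePWitnessZd`, socket p217536), prim-hp-8 lineage.  Site twin of `KSch.exists_exit` /
`KSch.mem_percolatesVia_of_infinite` of `L/KozmaNitzanTheorem6.lean`.  Helper file (`--supports stmt-CriticalPhenomena-4575`).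

* `exists_exit` — the certificate of (32) (KN p. 26, (3)): after a valid history of the run on `ω`, the site configuration
  `starRead ω` itself has a nearest-neighbour path of OPEN explored vertices from the origin to a lattice neighbour of
  `E_{w,v}` — (32) is a positive probability under the weighting pinned on the recorded vertex pattern, which on the
  initial event is the configuration's own;
* **`mem_sitePercolatesAt_of_infinite`** — on the initial event, an infinite final macro-cluster forces an infinite open
  SITE cluster of the origin (every occupied macro-vertex `v ≠ 0` was examined after a valid history whose certificate
  ends within `16r` of the centre of `v`; a vertex is that close to boundedly many centres only).
[cite: KozmaNitzan2024, §4 pp. 26–27 ((2), (3)), p. 28 ((32))]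
-/

noncomputable section

namespace Summit.CriticalPhenomena.PercolationContinuityZ3.Theorems.Transplant

namespace SiteKN

open MeasureTheory ProbabilityTheory
open Literature.Probability.Percolation Literature.Probability.LatticeModels
open Literature.Probability.Percolation.KozmaNitzan Literature.Probability.Percolation.KozmaNitzan.Cells
open GadgetSystem ProbeHistory Contour HSiteScheme
open SiteTransplant (siteConn mem_siteConn)
open SiteStar (starEdge starRead starEdge_injective mem_starRead)
open scoped Classical

variable {d : ℕ}

namespace SKSch

variable {S : SKSch d} {ω : BondConfig (Option (Site d))}

/-- On the initial event the cube `Q_0` is open in `starRead ω`. [folklore] -/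
theorem U₀V_subset_starRead (hA : ω ∈ initEvent S.scheme) : (↑S.U₀V : Set (Site d)) ⊆ starRead ω := by
  intro v hv
  rw [mem_starRead]
  exact hA (Finset.mem_coe.2 (starEdge_mem_stars.2 (Finset.mem_coe.1 hv)))

/-- **The certificate of (32)** (KN p. 26, (3)): after a valid history the site configuration has a path of open explored
vertices from the origin to a lattice neighbour of `E_{w,v}`. [cite: KozmaNitzan2024, §4 p. 26 ((3)) and p. 28 ((32))] -/
theorem exists_exit (hδc : S.δc ≤ 1) (hA : ω ∈ initEvent S.scheme)
    {n : ℕ} {e : Site 2 × MDir} (hV : S.Valid (S.hst ω n) e) :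
    ∃ a ∈ S.V (S.hst ω n), PathIn (zdGraph d) ((↑(S.V (S.hst ω n)) : Set (Site d)) ∩ starRead ω) 0 a ∧
      ∃ b ∈ S.C.Ewv e.1 e.2, (zdGraph d).Adj a b := by
  set W := S.W₀ (S.hst ω n) e with hW
  set Vn := S.V (S.hst ω n) with hVn
  have hI := S.runInv ω n
  have hpos : 0 < (prodBernoulli W).real (⋃ t ∈ S.C.M (tgt e), siteConn (zdGraph d) (0 : Site d) t) :=
    lt_of_le_of_lt (by linarith) hV.reach
  -- almost surely: no vertex of weight zero is open, and the pattern on `E_i` is the recorded one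
  have hae0 : ∀ᵐ η ∂prodBernoulli W, ∀ x ∈ {x : Site d | W x = 0}, x ∉ η :=
    prodBernoulli_ae_forall_notMem _ (Set.to_countable _) fun x hx => hx
  have haec : ∀ᵐ η ∂prodBernoulli W, η ∈ localCylinder (↑Vn : Set (Site d)) ↑(S.ξ (S.hst ω n)) := by
    have : W = pinW (siteRestrW (↑(Vn ∪ S.C.Ewv e.1 e.2) : Set (Site d)) fun _ : Site d => S.p) ↑Vn ↑(S.ξ (S.hst ω n)) := by
      rw [hW, W₀]
      exact siteRestrW_pinW_comm _ _ (Finset.coe_subset.2 Finset.subset_union_left)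
    rw [this]
    exact prodBernoulli_pinW_ae_localCylinder _ Vn.finite_toSet.countable _
  have hne : ((⋃ t ∈ S.C.M (tgt e), siteConn (zdGraph d) (0 : Site d) t) ∩
      ({η | ∀ x : Site d, W x = 0 → x ∉ η} ∩ localCylinder (↑Vn : Set (Site d)) ↑(S.ξ (S.hst ω n)))).Nonempty := by
    by_contra h
    rw [Set.not_nonempty_iff_eq_empty] at h
    have h1 : (prodBernoulli W).real ((⋃ t ∈ S.C.M (tgt e), siteConn (zdGraph d) (0 : Site d) t) ∩
        ({η | ∀ x : Site d, W x = 0 → x ∉ η} ∩ localCylinder (↑Vn : Set (Site d)) ↑(S.ξ (S.hst ω n)))) =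
        (prodBernoulli W).real (⋃ t ∈ S.C.M (tgt e), siteConn (zdGraph d) (0 : Site d) t) := by
      refine measureReal_congr ?_
      filter_upwards [hae0, haec] with η hη hηc
      exact propext ⟨fun h' => h'.1, fun h' => ⟨h', fun x hx => hη x hx, hηc⟩⟩
    rw [h, measureReal_empty] at h1
    linarith
  obtain ⟨η, hηA, hη0, hηc⟩ := hne
  simp only [Set.mem_iUnion, exists_prop] at hηA
  obtain ⟨t, ht, hreach⟩ := hηA
  -- every open vertex of `η` lies in `E_i ∪ E_{w,v}`
  have hηsub : η ⊆ (↑(Vn ∪ S.C.Ewv e.1 e.2) : Set (Site d)) := by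
    intro x hx
    by_contra hxS
    exact hη0 x (by rw [hW, W₀]; exact siteRestrW_apply_of_not_mem _ hxS) hx
  have hpath : PathIn (zdGraph d) ((↑(Vn ∪ S.C.Ewv e.1 e.2) : Set (Site d)) ∩ η) 0 t := by
    rw [← mem_siteConnIn_iff_pathIn]
    exact (mem_siteConn_iff_mem_siteConnIn_of_subset (zdGraph d) hηsub 0 t).1 hreach
  have htV : t ∉ (↑Vn : Set (Site d)) := fun h =>
    (Valid.sep_Q hV).not_mem h (Finset.mem_coe.2 (S.toKSch.M_subset_Q _ ht))
  obtain ⟨a, b, ha, hb, hbU, hab, hpa⟩ := hpath.exit (R := (↑Vn : Set (Site d))) (Finset.mem_coe.2 hV.zero_mem) htV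
  have hbE : b ∈ S.C.Ewv e.1 e.2 := by
    rcases Finset.mem_union.1 (Finset.mem_coe.1 hbU.1) with h | h
    · exact absurd (Finset.mem_coe.2 h) hb
    · exact h
  -- the initial segment is open in `starRead ω`
  refine ⟨a, Finset.mem_coe.1 ha, hpa.mono ?_, b, hbE, hab⟩
  rintro x ⟨hxV, -, hxη⟩
  refine ⟨hxV, ?_⟩
  have hxξ : x ∈ (↑(S.ξ (S.hst ω n)) : Set (Site d)) := (hηc x hxV).1 hxη
  rcases ((hI.ξ_iff x).1 (Finset.mem_coe.1 hxξ)).2 with h | h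
  · exact h
  · exact U₀V_subset_starRead hA (Finset.mem_coe.2 h)

/-- **An infinite macro-cluster forces an infinite open site cluster of the origin** (KN pp. 26–27: "the combination of (2)
and (3)"). [cite: KozmaNitzan2024, §4 pp. 26–27] -/
theorem mem_sitePercolatesAt_of_infinite (hδc : S.δc ≤ 1) (hA : ω ∈ initEvent S.scheme)
    (hinf : (S.scheme.occFinal ω).Infinite) : starRead ω ∈ sitePercolatesAt (zdGraph d) (0 : Site d) := by
  set Cl := siteCluster (zdGraph d) (starRead ω) 0 with hCl
  have hr1 : (1 : ℤ) ≤ S.C.r := by exact_mod_cast S.C.r_pos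
  have hnear : ∀ b ∈ S.scheme.occFinal ω, b ≠ 0 →
      ∃ a ∈ Cl, ∀ i : Fin 2, |20 * (S.C.r : ℤ) * b i - a (S.C.pax i)| ≤ 16 * S.C.r := by
    intro b hb hb0
    obtain ⟨n, hbn⟩ := Set.mem_iUnion.1 hb
    rcases S.scheme.exists_probe_of_det ω n b (Or.inl hbn) with h | ⟨m, -, e, P, hc, hte, hP, -⟩
    · exact absurd h hb0
    obtain ⟨e', hc', hV, rfl⟩ := S.of_next_some hP
    rw [hc] at hc'
    cases Option.some_injective _ hc'
    obtain ⟨a, -, hpa, b', hb', hab⟩ := exists_exit hδc hA hV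
    refine ⟨a, ?_, fun i => ?_⟩
    · have hconn := siteConnIn_subset_siteConn _ _ _ _ (PathIn.mem_siteConnIn hpa)
      rw [mem_siteConn] at hconn
      exact ⟨hconn.1, hconn.2.1, hconn.2.2⟩
    · -- `b'` is within `15r` of `cen b`, and `a ∼ b'`
      subst hte
      have htgt : tgt e = e.1 + stepVec e.2 := rfl
      rw [htgt]
      have hab1 := abs_sub_le_one_of_adj hab (S.C.pax i)
      have hb'c : |b' (S.C.pax i) - 20 * S.C.r * (e.1 + stepVec e.2) i| ≤ 15 * S.C.r := by
        rcases Finset.mem_union.1 hb' with h | h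
        · obtain ⟨⟨hl1, hl2⟩, ht1, ht2⟩ := S.C.planar_of_mem_sBox h
          by_cases hi : i = e.2.1
          · subst hi
            have hta : (e.1 + stepVec e.2) e.2.1 = e.1 e.2.1 + sgOf e.2 := by
              rw [Pi.add_apply, stepVec_apply_fst]
            rw [hta, abs_le]
            rcases sgOf_sign e.2 with hs | hs <;> rw [hs] at hl1 hl2 ⊢ <;> constructor <;> nlinarith
          · have hi' : i = oth e.2.1 := eq_oth_of_ne hi
            subst hi'
            have hta : (e.1 + stepVec e.2) (oth e.2.1) = e.1 (oth e.2.1) := by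
              rw [Pi.add_apply, stepVec_apply_oth, add_zero]
            rw [hta, abs_le]; constructor <;> linarith
        · have := S.C.planar_of_mem_cIcc h i
          push_cast at this
          rw [abs_le]; constructor <;> linarith [this.1, this.2]
      have := abs_sub_abs_le_abs_sub (20 * (S.C.r : ℤ) * (e.1 + stepVec e.2) i - a (S.C.pax i))
        (20 * S.C.r * (e.1 + stepVec e.2) i - b' (S.C.pax i))
      have e1 : 20 * (S.C.r : ℤ) * (e.1 + stepVec e.2) i - a (S.C.pax i) - (20 * S.C.r * (e.1 + stepVec e.2) i - b' (S.C.pax i)) =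
          b' (S.C.pax i) - a (S.C.pax i) := by ring
      rw [e1] at this
      rw [abs_sub_comm] at hb'c
      linarith
  by_contra hfin
  have hClfin : Cl.Finite := Set.not_infinite.1 hfin
  have hF : (⋃ a ∈ Cl, {b : Site 2 | ∀ i : Fin 2, |20 * (S.C.r : ℤ) * b i - a (S.C.pax i)| ≤ 16 * S.C.r}).Finite :=
    hClfin.biUnion fun a _ => S.toKSch.finite_setOf_near a
  refine hinf ((hF.union (Set.finite_singleton 0)).subset fun b hb => ?_)
  by_cases hb0 : b = 0
  · exact Or.inr hb0
  · obtain ⟨a, ha, hnr⟩ := hnear b hb hb0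
    exact Or.inl (Set.mem_biUnion ha hnr)

end SKSch

end SiteKN

end Summit.CriticalPhenomena.PercolationContinuityZ3.Theorems.Transplant

end
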